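import Summits.QuantumFields.YangMills.Theorems.LangevinControlUVFemtoCurvatureTwoPointStrictRPGramStrict
import Summits.QuantumFields.YangMills.Theorems.LangevinControlUVFemtoCurvatureTwoPointStrictRPSWVanish
import Summits.QuantumFields.YangMills.Theorems.LangevinControlUVFemtoCurvatureTwoPointStrictRPSliceKernel
import Literature.Barriers.QuantumFields.DiscreteSubgroupFreezing

/-!
# Crux `FemtoCurvatureTwoPoint` (stmt-QuantumFields-9363, route `LangevinControlUV`):
# strict positivity of the axis covariance, IV — the slice lemma

Helper for the registered sub-goal `stub_axisPositive` (`--supports stmt-QuantumFields-9363`).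
**The slice lemma** (`false_of_forall_integral_sliceKernel_eq_zero`): for a compact group `G ≠ 1`
with a continuous faithful unitary representation `ρ`, `β > 0`, a set of links `E` containing the four
links of a plaquette `p`, a continuous positive weight `r` and a real `m`, the function
`(Re tr ρ(U_p) − m) · r` cannot be annihilated by the slice kernel `K_E(A, ·)` for every boundary
configuration `A`. Proof: average over the links off `E`; the exponential Gram form of the average
vanishes; by the Gram expansion (`GramStrict`) the average is orthogonal to all monomials in the
matrix entries of `ρ(W_e)`, `e ∈ E`, which separate the points of `G^E` (faithfulness), so it
vanishes identically (Stone–Weierstrass, `SWVanish`); hence `Re tr ρ(U_p)` would be constant, which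
fails between the trivial configuration and a one-link excitation (`Re tr ρ(g) = N ⇒ g = 1`).
This is the injectivity of one transfer step of Wilson's lattice gauge theory for a faithful
representation (strict form of Osterwalder–Seiler positivity, Seiler LNP 159 Ch. 2).
-/

set_option autoImplicit false

noncomputable section

namespace Summit.QuantumFields.YangMills.Theorems.FemtoCurvatureTwoPoint.StrictRP

open MeasureTheory Finset
open scoped Matrix ComplexConjugate
open Literature.MathematicalPhysics.QuantumFieldTheory

variable {d L N : ℕ} {G : Type*} [Group G] [TopologicalSpace G] [IsTopologicalGroup G]
  [CompactSpace G] [MeasurableSpace G] [BorelSpace G] (ρ : G →* Matrix (Fin N) (Fin N) ℂ)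

/-! ## The slice lemma -/

section SliceLemma

variable [NeZero L]

/-- **The slice lemma (a faithful one-step transfer is injective).** Let `ρ` be a continuous,
faithful, unitary representation of the compact group `G ≠ 1`, `β > 0`, `E` a set of links
containing the four links of the plaquette `p`, `r` a continuous positive function of the
configuration and `m` a real number. If the function `w = (Re tr ρ(U_p) − m) · r` is annihilated by
the slice kernel of `E` — `∫ w(W) exp(β ∑_{e∈E} ⟪ρ(A_e), ρ(W_e)⟫) dW = 0` for EVERY configuration `A` —
then we reach a contradiction. Mechanism: average `w` over the links off `E`
(`w̄ = (Re tr ρ(U_p) − m) · r̄`, `r̄ > 0`), so that `∫∫ w̄ w̄ K = 0`; the Gram expansion of the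
exponential kernel (`GramStrict`) makes `w̄` orthogonal to every monomial in the matrix entries of
the `ρ(W_e)`, `e ∈ E`; these separate the points of `G^E` (faithfulness), so `w̄ = 0` by
Stone–Weierstrass (`SWVanish`); hence `Re tr ρ(U_p) = m` identically, which fails at the trivial
configuration versus a one-link excitation (`Re tr ρ(g) = N` forces `g = 1`). [folklore] -/
theorem false_of_forall_integral_sliceKernel_eq_zero [Fact (1 < L)] (hρ : Continuous ρ)
    (hinj : Function.Injective ρ) (hunit : ∀ g, ρ g ∈ Matrix.unitaryGroup (Fin N) ℂ)
    (hG : ∃ g : G, g ≠ 1) {β : ℝ} (hβ : 0 < β) (E : Finset (Edge d L)) (p : Plaquette d L)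
    (h1 : (p.1, p.2.1.1) ∈ E) (h2 : (p.1.shift p.2.1.1, p.2.1.2) ∈ E)
    (h3 : (p.1.shift p.2.1.2, p.2.1.1) ∈ E) (h4 : (p.1, p.2.1.2) ∈ E)
    (r : GaugeConfig d L G → ℝ) (hrc : Continuous r) (hrm : Measurable r) {Kr : ℝ}
    (hrb : ∀ W, |r W| ≤ Kr) (hrpos : ∀ W, 0 < r W) (m : ℝ)
    (h0 : ∀ A : GaugeConfig d L G,
      ∫ W, (WilsonRP.plaqRe ρ W p - m) * r W * sliceKernel ρ β E A W
        ∂(LatticeRP.piMeasure (ι := Edge d L) (haarProbability G)) = 0) :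
    False := by
  classical
  haveI hT2 : T2Space G := (hρ.isClosedEmbedding hinj).isEmbedding.t2Space
  haveI hSC : SecondCountableTopology G :=
    haveI : SecondCountableTopology (Matrix (Fin N) (Fin N) ℂ) :=
      inferInstanceAs (SecondCountableTopology (Fin N → Fin N → ℂ))
    (hρ.isClosedEmbedding hinj).isEmbedding.secondCountableTopology
  set μ : Measure (GaugeConfig d L G) := LatticeRP.piMeasure (ι := Edge d L) (haarProbability G)
    with hμ
  -- shorthand
  set P : GaugeConfig d L G → ℝ := fun W => WilsonRP.plaqRe ρ W p with hP
  have hPm : Measurable P := WilsonRP.measurable_plaqRe ρ hρ p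
  have hPc : Continuous P := continuous_plaqRe ρ hρ p
  have hPb : ∀ W, |P W| ≤ N := fun W => WilsonRP.abs_plaqRe_le ρ hρ W p
  have hK0 : 0 ≤ Kr := (abs_nonneg _).trans (hrb fun _ => 1)
  set Ec : Finset (Edge d L) := Eᶜ with hEc
  have h1c : (p.1, p.2.1.1) ∉ Ec := by rw [hEc, Finset.mem_compl]; exact fun h => h h1
  have h2c : (p.1.shift p.2.1.1, p.2.1.2) ∉ Ec := by rw [hEc, Finset.mem_compl]; exact fun h => h h2
  have h3c : (p.1.shift p.2.1.2, p.2.1.1) ∉ Ec := by rw [hEc, Finset.mem_compl]; exact fun h => h h3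
  have h4c : (p.1, p.2.1.2) ∉ Ec := by rw [hEc, Finset.mem_compl]; exact fun h => h h4
  have hPsplice : ∀ W Y, P (LatticeRP.splice Ec (W, Y)) = P W := fun W Y =>
    plaqRe_splice_of_not_mem ρ Ec p h1c h2c h3c h4c W Y
  -- ### Step 1: the averaged weight `r̄` and the averaged function `w̄ = (P - m) r̄`
  set rbar : GaugeConfig d L G → ℝ := fun W => ∫ Y, r (LatticeRP.splice Ec (W, Y)) ∂μ with hrbar
  set wbar : GaugeConfig d L G → ℝ := fun W => (P W - m) * rbar W with hwbar
  have hr_int : ∀ W, Integrable (fun Y => r (LatticeRP.splice Ec (W, Y))) μ := fun W =>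
    Integrable.of_bound ((hrm.comp ((LatticeRP.measurable_splice Ec).comp
      (measurable_const.prodMk measurable_id))).aestronglyMeasurable) Kr
      (ae_of_all _ fun Y => by rw [Real.norm_eq_abs]; exact hrb _)
  have hwbar_int : ∀ W, wbar W = ∫ Y, (P (LatticeRP.splice Ec (W, Y)) - m) *
      r (LatticeRP.splice Ec (W, Y)) ∂μ := fun W => by
    simp only [hwbar, hrbar, hPsplice]
    rw [integral_const_mul]
  -- `r̄` is positive: `r` has a positive minimum on the compact configuration space
  obtain ⟨rmin, hrmin, hrmin_le⟩ : ∃ c : ℝ, 0 < c ∧ ∀ W, c ≤ r W := by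
    obtain ⟨W₀, _, hW₀⟩ := isCompact_univ.exists_isMinOn (Set.univ_nonempty) hrc.continuousOn
    exact ⟨r W₀, hrpos W₀, fun W => hW₀ (Set.mem_univ W)⟩
  have hrbar_pos : ∀ W, 0 < rbar W := fun W => by
    have h : rmin ≤ rbar W := by
      have : ∫ _Y, rmin ∂μ = rmin := by rw [integral_const, probReal_univ, one_smul]
      rw [← this]
      exact integral_mono (integrable_const _) (hr_int W) fun Y => hrmin_le _
    exact hrmin.trans_le h
  -- `r̄`, `w̄` are continuous, measurable, bounded
  have hrbar_c : Continuous rbar := continuous_integral_splice Ec hrc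
  have hrbar_m : Measurable rbar :=
    measurable_integral_parametric_real (hrm.comp (LatticeRP.measurable_splice Ec))
  have hrbar_b : ∀ W, |rbar W| ≤ Kr := fun W => by
    rw [← Real.norm_eq_abs]
    refine (norm_integral_le_of_norm_le_const (ae_of_all _ fun Y => ?_)).trans_eq
      (by rw [probReal_univ, mul_one])
    rw [Real.norm_eq_abs]; exact hrb _
  have hwbar_c : Continuous wbar := (hPc.sub continuous_const).mul hrbar_c
  have hwbar_m : Measurable wbar := (hPm.sub measurable_const).mul hrbar_m
  have hwbar_b : ∀ W, |wbar W| ≤ (N + |m|) * Kr := fun W => by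
    rw [hwbar, abs_mul]
    refine mul_le_mul ((abs_sub _ _).trans (add_le_add (hPb W) le_rfl)) (hrbar_b W)
      (abs_nonneg _) (by positivity)
  -- ### Step 2: `w̄` is annihilated by the slice kernel
  have hKsplice : ∀ A W Y, sliceKernel ρ β E A (LatticeRP.splice Ec (W, Y)) = sliceKernel ρ β E A W := by
    intro A W Y
    unfold sliceKernel
    congr 2
    refine Finset.sum_congr rfl fun e he => ?_
    have hec : e ∉ Ec := by rw [hEc, Finset.mem_compl]; exact fun h => h he
    simp only [LatticeRP.splice_apply, hec, if_false]
  have hKm : ∀ A, Measurable (sliceKernel ρ β E A) := fun A => by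
    unfold sliceKernel
    refine (measurable_const.mul (Finset.measurable_sum _ fun e _ => ?_)).exp
    unfold pairing
    have hW : WilsonRP.EntryMeasurable ρ fun W : GaugeConfig d L G => W e :=
      WilsonRP.entryMeasurable_apply hρ e
    simp only [Matrix.trace, Matrix.diag_apply, Matrix.mul_apply, Matrix.conjTranspose_apply,
      Complex.re_sum]
    refine Finset.measurable_sum _ fun a _ => Finset.measurable_sum _ fun b _ => ?_
    exact Complex.measurable_re.comp (measurable_const.mul
      (Complex.continuous_conj.measurable.comp (hW a b)))
  have hpair : ∀ g h : G, pairing ρ g h ≤ 2 * (N : ℝ) ^ 2 := by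
    intro g h
    rw [pairing_eq_sum]
    calc ∑ a, ∑ b, ((ρ g a b).re * (ρ h a b).re + (ρ g a b).im * (ρ h a b).im)
        ≤ ∑ _a : Fin N, ∑ _b : Fin N, (2 : ℝ) :=
          Finset.sum_le_sum fun a _ => Finset.sum_le_sum fun b _ => ?_
      _ = 2 * (N : ℝ) ^ 2 := by
          simp only [Finset.sum_const, Finset.card_univ, Fintype.card_fin, nsmul_eq_mul]; ring
    have hg1 := entry_norm_bound_of_unitary (hunit g) a b
    have hh1 := entry_norm_bound_of_unitary (hunit h) a b
    have e1 : |(ρ g a b).re| ≤ 1 := (Complex.abs_re_le_norm _).trans hg1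
    have e2 : |(ρ h a b).re| ≤ 1 := (Complex.abs_re_le_norm _).trans hh1
    have e3 : |(ρ g a b).im| ≤ 1 := (Complex.abs_im_le_norm _).trans hg1
    have e4 : |(ρ h a b).im| ≤ 1 := (Complex.abs_im_le_norm _).trans hh1
    have p1 : (ρ g a b).re * (ρ h a b).re ≤ 1 :=
      (le_abs_self _).trans (by rw [abs_mul]; exact mul_le_one₀ e1 (abs_nonneg _) e2)
    have p2 : (ρ g a b).im * (ρ h a b).im ≤ 1 :=
      (le_abs_self _).trans (by rw [abs_mul]; exact mul_le_one₀ e3 (abs_nonneg _) e4)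
    linarith
  have hKb : ∀ A W, |sliceKernel ρ β E A W| ≤ Real.exp (β * (E.card * (2 * (N : ℝ) ^ 2))) := by
    intro A W
    unfold sliceKernel
    rw [abs_of_pos (Real.exp_pos _)]
    refine Real.exp_le_exp.2 (mul_le_mul_of_nonneg_left ?_ hβ.le)
    calc ∑ e ∈ E, pairing ρ (A e) (W e) ≤ ∑ _e ∈ E, (2 * (N : ℝ) ^ 2) :=
          Finset.sum_le_sum fun e _ => hpair _ _
      _ = E.card * (2 * (N : ℝ) ^ 2) := by rw [Finset.sum_const, nsmul_eq_mul]
  have step2 : ∀ A, ∫ W, wbar W * sliceKernel ρ β E A W ∂μ = 0 := by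
    intro A
    have hΦm : Measurable fun W => (P W - m) * r W * sliceKernel ρ β E A W :=
      ((hPm.sub measurable_const).mul hrm).mul (hKm A)
    have hΦb : ∀ W, |(P W - m) * r W * sliceKernel ρ β E A W| ≤
        (N + |m|) * Kr * Real.exp (β * (E.card * (2 * (N : ℝ) ^ 2))) := fun W => by
      rw [abs_mul, abs_mul]
      refine mul_le_mul (mul_le_mul ((abs_sub _ _).trans (add_le_add (hPb W) le_rfl)) (hrb W)
        (abs_nonneg _) (by positivity)) (hKb A W) (abs_nonneg _) (by positivity)
    have hsp := integral_eq_integral_integral_splice Ec hΦm hΦb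
    rw [h0 A] at hsp
    rw [hsp]
    refine integral_congr_ae (ae_of_all _ fun W => ?_)
    simp only [hKsplice]
    rw [integral_mul_const, hwbar_int]
  -- ### Step 3: the exponential Gram form of `w̄` vanishes
  have step3 : ∫ q, wbar q.1 * wbar q.2 *
      Real.exp (∑ i : FeatIndex E N, feature ρ β i q.1 * feature ρ β i q.2) ∂(μ.prod μ) = 0 := by
    have hform : ∀ q : GaugeConfig d L G × GaugeConfig d L G, wbar q.1 * wbar q.2 *
        Real.exp (∑ i : FeatIndex E N, feature ρ β i q.1 * feature ρ β i q.2) =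
        wbar q.1 * (wbar q.2 * sliceKernel ρ β E q.1 q.2) := fun q => by
      rw [← sliceKernel_eq_exp_sum ρ hβ.le]; ring
    simp_rw [hform]
    have hint : Integrable (fun q : GaugeConfig d L G × GaugeConfig d L G =>
        wbar q.1 * (wbar q.2 * sliceKernel ρ β E q.1 q.2)) (μ.prod μ) := by
      have hm2 : Measurable fun q : GaugeConfig d L G × GaugeConfig d L G =>
          sliceKernel ρ β E q.1 q.2 := by
        rw [show (fun q : GaugeConfig d L G × GaugeConfig d L G => sliceKernel ρ β E q.1 q.2) =
          fun q => Real.exp (∑ i : FeatIndex E N, feature ρ β i q.1 * feature ρ β i q.2) from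
          funext fun q => sliceKernel_eq_exp_sum ρ hβ.le E q.1 q.2]
        exact (Finset.measurable_sum _ fun i _ => ((measurable_feature ρ hρ β i).comp measurable_fst).mul
          ((measurable_feature ρ hρ β i).comp measurable_snd)).exp
      refine Integrable.of_bound (((hwbar_m.comp measurable_fst).mul
        ((hwbar_m.comp measurable_snd).mul hm2)).aestronglyMeasurable)
        (((N + |m|) * Kr) * (((N + |m|) * Kr) * Real.exp (β * (E.card * (2 * (N : ℝ) ^ 2))))) (ae_of_all _ fun q => ?_)
      rw [Real.norm_eq_abs]
      calc |wbar q.1 * (wbar q.2 * sliceKernel ρ β E q.1 q.2)|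
          = |wbar q.1| * (|wbar q.2| * |sliceKernel ρ β E q.1 q.2|) := by
            rw [← abs_mul, ← abs_mul]
        _ ≤ ((N + |m|) * Kr) * (((N + |m|) * Kr) * Real.exp (β * (E.card * (2 * (N : ℝ) ^ 2)))) :=
            mul_le_mul (hwbar_b q.1) (mul_le_mul (hwbar_b q.2) (hKb q.1 q.2) (abs_nonneg _)
              (by positivity)) (by positivity) (by positivity)
    rw [integral_prod _ hint]
    simp only [integral_const_mul, step2, mul_zero, integral_zero]
  -- ### Step 4: every Gram word of `w̄` vanishes
  have step4 : ∀ (n : ℕ) (word : Fin n → FeatIndex E N),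
      ∫ W, wbar W * ∏ t, feature ρ β (word t) W ∂μ = 0 := fun n word =>
    GramStrict.integral_mul_prod_eq_zero_of_integral_exp_gram_eq_zero μ wbar (feature ρ β) hwbar_m
      (fun i => measurable_feature ρ hρ β i) hwbar_b (fun i W => abs_feature_le ρ hunit β i W) step3 word
  -- ### Step 5: transfer to the slice `G^E` and apply Stone–Weierstrass
  set X : Type _ := ↥E → G with hX
  set π : GaugeConfig d L G → X := fun W e => W e with hπ
  set ext : X → GaugeConfig d L G := fun x e => if h : e ∈ E then x ⟨e, h⟩ else 1 with hext
  have hπm : Measurable π := measurable_pi_lambda _ fun e => measurable_pi_apply _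
  have hext_c : Continuous ext := by
    refine continuous_pi fun e => ?_
    by_cases he : e ∈ E
    · simp only [hext, he, dif_pos]; exact continuous_apply _
    · simp only [hext, he, dif_neg, not_false_eq_true]; exact continuous_const
  have hext_π : ∀ (W : GaugeConfig d L G) (e : Edge d L), e ∈ E → ext (π W) e = W e := by
    intro W e he; simp only [hext, hπ, he, dif_pos]
  -- `w̄` and the features depend only on the `E`-links
  have hsplice_ext : ∀ W Y, LatticeRP.splice Ec (ext (π W), Y) = LatticeRP.splice Ec (W, Y) := by
    intro W Y; funext e
    simp only [LatticeRP.splice_apply]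
    by_cases he : e ∈ Ec
    · simp only [he, if_true]
    · simp only [he, if_false]
      have heE : e ∈ E := by
        by_contra hh; exact he (by rw [hEc, Finset.mem_compl]; exact hh)
      exact hext_π W e heE
  have hwbar_dep : ∀ W, wbar (ext (π W)) = wbar W := fun W => by
    rw [hwbar_int, hwbar_int]; simp only [hsplice_ext]
  have hfeat_dep : ∀ (i : FeatIndex E N) (W : GaugeConfig d L G),
      feature ρ β i (ext (π W)) = feature ρ β i W := fun i W => by
    unfold feature; rw [hext_π W i.1 i.1.2]
  set μX : Measure X := Measure.pi fun _ : ↥E => haarProbability G with hμX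
  have hmap : μ.map π = μX := map_restrict_piMeasure E
  haveI : (haarProbability G).IsOpenPosMeasure := by unfold haarProbability; infer_instance
  let wX : C(X, ℝ) := ⟨fun x => wbar (ext x), hwbar_c.comp hext_c⟩
  let φX : FeatIndex E N → C(X, ℝ) := fun i => ⟨fun x => feature ρ β i (ext x),
    (continuous_feature ρ hρ β i).comp hext_c⟩
  have hzeroX : ∀ (n : ℕ) (word : Fin n → FeatIndex E N),
      ∫ x, wX x * ∏ t, φX (word t) x ∂μX = 0 := by
    intro n word
    have hm : Measurable fun x : X => wX x * ∏ t, φX (word t) x :=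
      (wX.continuous.mul (continuous_finsetProd _ fun t _ => (φX (word t)).continuous)).measurable
    rw [← hmap, integral_map hπm.aemeasurable hm.aestronglyMeasurable]
    simp only [wX, φX, ContinuousMap.coe_mk, hwbar_dep, hfeat_dep]
    exact step4 n word
  have hsep : ∀ x y : X, x ≠ y → ∃ i, φX i x ≠ φX i y := by
    intro x y hxy
    obtain ⟨e, he⟩ : ∃ e : ↥E, x e ≠ y e := by
      by_contra hh; push Not at hh; exact hxy (funext hh)
    have hρne : ρ (x e) ≠ ρ (y e) := fun h => he (hinj h)
    obtain ⟨a, b, hab⟩ : ∃ a b, ρ (x e) a b ≠ ρ (y e) a b := by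
      by_contra hh; push Not at hh; exact hρne (Matrix.ext fun a b => hh a b)
    have hxe : ext x e = x e := by simp only [hext, e.2, dif_pos]
    have hye : ext y e = y e := by simp only [hext, e.2, dif_pos]
    have hsq : Real.sqrt β ≠ 0 := (Real.sqrt_pos.2 hβ).ne'
    by_cases hre : (ρ (x e) a b).re = (ρ (y e) a b).re
    · have him : (ρ (x e) a b).im ≠ (ρ (y e) a b).im := fun h => hab (Complex.ext hre h)
      refine ⟨(e, a, b, false), ?_⟩
      simp only [φX, ContinuousMap.coe_mk, feature, Bool.false_eq_true, if_false, hxe, hye]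
      exact fun h => him (mul_left_cancel₀ hsq h)
    · refine ⟨(e, a, b, true), ?_⟩
      simp only [φX, ContinuousMap.coe_mk, feature, if_true, hxe, hye]
      exact fun h => hre (mul_left_cancel₀ hsq h)
  have hwX : wX = 0 := SWVanish.eq_zero_of_forall_integral_mul_word μX φX hsep wX hzeroX
  -- ### Step 6: hence `Re tr ρ(U_p) = m` identically
  have hPconst : ∀ W, P W = m := fun W => by
    have h := congr_fun (congrArg DFunLike.coe hwX) (π W)
    simp only [wX, ContinuousMap.coe_mk, ContinuousMap.zero_apply, hwbar_dep] at h
    rw [hwbar] at h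
    have h' : P W - m = 0 := by
      rcases mul_eq_zero.1 h with h | h
      · exact h
      · exact absurd h (hrbar_pos W).ne'
    linarith
  -- ### Step 7: contradiction at the trivial configuration versus a one-link excitation
  obtain ⟨g, hg⟩ := hG
  have hN : (N : ℝ) = m := by rw [← hPconst (fun _ => 1)]; exact (plaqRe_one ρ p).symm
  have htr : (ρ g).trace.re = N := by
    rw [hN, ← hPconst (Function.update (fun _ => (1 : G)) (p.1, p.2.1.1) g)]
    exact (plaqRe_update ρ p g).symm
  have hρg : ρ g = 1 := Literature.Barriers.QuantumFields.eq_one_of_re_trace_eq (hunit g) htr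
  exact hg (hinj (hρg.trans (map_one ρ).symm))

end SliceLemma

/-- **Registered sub-goal `stub_sliceLemma`** (`--supports stmt-QuantumFields-9363`): closed form of `false_of_forall_integral_sliceKernel_eq_zero` — one transfer step of Wilson's theory is injective for a faithful representation. [folklore] -/
theorem stub_sliceLemma : ∀ (d L N : ℕ) [NeZero L] [Fact (1 < L)] (G : Type) [Group G] [TopologicalSpace G] [IsTopologicalGroup G] [CompactSpace G] [MeasurableSpace G] [BorelSpace G] (ρ : G →* Matrix (Fin N) (Fin N) ℂ), Continuous ρ → Function.Injective ρ → (∀ g, ρ g ∈ Matrix.unitaryGroup (Fin N) ℂ) → (∃ g : G, g ≠ 1) → ∀ (β : ℝ), 0 < β → ∀ (E : Finset (Literature.MathematicalPhysics.QuantumFieldTheory.Edge d L)) (p : Literature.MathematicalPhysics.QuantumFieldTheory.Plaquette d L), (p.1, p.2.1.1) ∈ E → (p.1.shift p.2.1.1, p.2.1.2) ∈ E → (p.1.shift p.2.1.2, p.2.1.1) ∈ E → (p.1, p.2.1.2) ∈ E → ∀ (r : Literature.MathematicalPhysics.QuantumFieldTheory.GaugeConfig d L G → ℝ), Continuous r →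 Measurable r → ∀ (Kr : ℝ), (∀ W, |r W| ≤ Kr) → (∀ W, 0 < r W) → ∀ (m : ℝ), (∀ A : Literature.MathematicalPhysics.QuantumFieldTheory.GaugeConfig d L G, (∫ W, (Literature.MathematicalPhysics.QuantumFieldTheory.WilsonRP.plaqRe ρ W p - m) * r W * Summit.QuantumFields.YangMills.Theorems.FemtoCurvatureTwoPoint.StrictRP.sliceKernel ρ β E A W ∂(Literature.MathematicalPhysics.QuantumFieldTheory.LatticeRP.piMeasure (ι := Literature.MathematicalPhysics.QuantumFieldTheory.Edge d L) (Literature.MathematicalPhysics.QuantumFieldTheory.haarProbability G))) = 0) → False := by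
  intro d L N _ _ G _ _ _ _ _ _ ρ hρ hinj hunit hG β hβ E p h1 h2 h3 h4 r hrc hrm Kr hrb hrpos m h0
  exact false_of_forall_integral_sliceKernel_eq_zero ρ hρ hinj hunit hG hβ E p h1 h2 h3 h4 r hrc hrm hrb hrpos m h0

end Summit.QuantumFields.YangMills.Theorems.FemtoCurvatureTwoPoint.StrictRP

end
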